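import Mathlib
import Summits.Ventures.PercRepro2.Defs
import Summits.Ventures.PercRepro2.Graph
import Summits.Ventures.PercRepro2.OneColourSwitch
import Summits.Ventures.PercRepro2.RegionHubSign
import Summits.Ventures.PercRepro2.SideSwitch
import Summits.Ventures.PercRepro2.M9NoPocketDefs
import Summits.Ventures.PercRepro2.M9PocketRSEdgeTransfer

/-!
# A root-only cluster does not change the single-`d` data (blind cell PercRepro2, p3 g41,
2026-08-29; `proofs/P3-POCKETRK.md` §10⁵: the first linking blocks in the kernel)

A ROOT-ONLY CLUSTER is a vertex set `L` (not containing `p, q, r, s, d`) every edge of which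
has its other endpoint in `L`, `r` or `s` — an arbitrary structure hanging from `r, s` alone,
e.g. every UNATTACHED linking free block of `G − d`.  Let `F` be the edges inside `L ∪ {r, s}`
(the edges inside `{r, s}` of `M9PocketRSEdgeTransfer` are the case `L = ∅`).  Off `F` the
cluster is isolated (`notMem_L_of_conn_restrict`), and a path of `G` from a vertex off `L` that
leaves the restriction does so through `r` or `s` (`exit_of_conn`).  Hence, off `L`, the worlds
of `{r, s}` are those of the restriction (`mem_K2_restrict_iff_of_notMem`), `Sep` is unchanged
(`sep2_restrict_iff_rootOnly`), `σ_pq` is unchanged at a `Sep` point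
(`sigma_pq_restrict_eq_rootOnly`), the worlds ON `L` are those of the `F`-graph alone
(`mem_K2_F_iff_of_mem`), `DOne` splits into `DOne` of the restriction and the same condition on
`L` read in the `F`-graph (`DOne_restrict_iff_rootOnly`), and `r ~_Y s` holds iff it holds in
the restriction or in the `F`-graph (`conn_rs_restrict_iff_rootOnly`).  Own work; std axioms.
-/

namespace Summit.Ventures.PercRepro2

namespace NoPocket

open Finset Classical OneColourSwitch SideSwitch

variable {V : Type*} {E : Type*} {ends : E → Sym2 V} {p q r s d : V} {ω : Config E} {L : Set V}

section Cluster

/-- The endpoints of an edge inside `S` lie in `S`. -/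
lemma mem_of_mem_within {S : Set V} {e : E} (he : e ∈ within ends S) {a b : V}
    (hab : ends e = s(a, b)) : a ∈ S ∧ b ∈ S := by
  obtain ⟨u, hu, v, hv, huv⟩ := he
  rw [hab, Sym2.eq_iff] at huv
  rcases huv with ⟨h1, h2⟩ | ⟨h1, h2⟩
  · rw [h1, h2]; exact ⟨hu, hv⟩
  · rw [h1, h2]; exact ⟨hv, hu⟩

/-- An edge at a vertex of the root-only cluster `L` lies inside `L ∪ {r, s}`. -/
lemma mem_within_of_mem_L (hL : ∀ e x y, ends e = s(x, y) → x ∈ L → y ∈ L ∨ y = r ∨ y = s)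
    {e : E} {a b : V} (hab : ends e = s(a, b)) (ha : a ∈ L) :
    e ∈ within ends (L ∪ {r, s} : Set V) := by
  refine ⟨a, Or.inl ha, b, ?_, hab⟩
  rcases hL e a b hab ha with h | h | h
  · exact Or.inl h
  · exact Or.inr (by rw [h]; simp)
  · exact Or.inr (by rw [h]; simp)

/-- An edge off `F` (the edges inside `L ∪ {r, s}`) has no endpoint in `L`. -/
lemma notMem_L_of_notMem_within (hL : ∀ e x y, ends e = s(x, y) → x ∈ L → y ∈ L ∨ y = r ∨ y = s)
    {e : E} (he : e ∉ within ends (L ∪ {r, s} : Set V)) {a b : V} (hab : ends e = s(a, b)) :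
    a ∉ L ∧ b ∉ L := by
  constructor
  · intro ha
    exact he (mem_within_of_mem_L hL hab ha)
  · intro hb
    exact he (mem_within_of_mem_L hL (by rw [hab, Sym2.eq_swap]) hb)

/-- A restricted path (edges off `F`) from a vertex off `L` never enters `L`. -/
lemma notMem_L_of_conn_restrict
    (hL : ∀ e x y, ends e = s(x, y) → x ∈ L → y ∈ L ∨ y = r ∨ y = s) {x y : V} (hx : x ∉ L)
    (h : Conn (fun e : {e // e ∉ within ends (L ∪ {r, s} : Set V)} => ends e.1)
      (fun e => ω e.1) x y) : y ∉ L := by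
  have key : y ∈ {z | z ∉ L} := by
    refine mem_of_conn_of_closed (S := {z | z ∉ L}) ?_ hx h
    intro a _ b hab
    obtain ⟨_, e, _, hends⟩ := openGraph_adj.1 hab
    exact (notMem_L_of_notMem_within hL e.2 hends).2
  exact key

/-- **The exit lemma**: a `Y`-path of `G` from a vertex `x` off `L` either is a restricted path
or leaves the restriction through `r` or `s`. -/
lemma exit_of_conn (hL : ∀ e x y, ends e = s(x, y) → x ∈ L → y ∈ L ∨ y = r ∨ y = s) {x y : V}
    (hx : x ∉ L) (h : Conn ends ω x y) :
    Conn (fun e : {e // e ∉ within ends (L ∪ {r, s} : Set V)} => ends e.1) (fun e => ω e.1) x y ∨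
    Conn (fun e : {e // e ∉ within ends (L ∪ {r, s} : Set V)} => ends e.1) (fun e => ω e.1) x r ∨
    Conn (fun e : {e // e ∉ within ends (L ∪ {r, s} : Set V)} => ends e.1) (fun e => ω e.1) x s := by
  refine mem_of_conn_of_closed (S := {z |
    Conn (fun e : {e // e ∉ within ends (L ∪ {r, s} : Set V)} => ends e.1) (fun e => ω e.1) x z ∨
    Conn (fun e : {e // e ∉ within ends (L ∪ {r, s} : Set V)} => ends e.1) (fun e => ω e.1) x r ∨
    Conn (fun e : {e // e ∉ within ends (L ∪ {r, s} : Set V)} => ends e.1) (fun e => ω e.1) x s})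
    ?_ (Or.inl (conn_refl _ _ _)) h
  intro a ha b hab
  obtain ⟨_, e, he, hends⟩ := openGraph_adj.1 hab
  by_cases hP : e ∈ within ends (L ∪ {r, s} : Set V)
  · -- an edge inside `L ∪ {r, s}`: `a` is `r`, `s`, or in `L` (impossible on a restricted path)
    obtain ⟨ha', _⟩ := mem_of_mem_within hP hends
    simp only [Set.mem_union, Set.mem_insert_iff, Set.mem_singleton_iff] at ha'
    rcases ha' with haL | rfl | rfl
    · exact ha.elim (fun h => (notMem_L_of_conn_restrict hL hx h haL).elim) Or.inr
    · exact Or.inr (ha.elim Or.inl id)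
    · exact Or.inr (ha.elim Or.inr id)
  · rcases ha with ha | ha | ha
    · exact Or.inl (conn_trans ha (conn_of_openAdj ⟨⟨e, hP⟩, he, hends⟩))
    · exact Or.inr (Or.inl ha)
    · exact Or.inr (Or.inr ha)

/-- **Off `L`, the `Y`-world of `{r, s}` is that of the restriction.** -/
lemma mem_K2_restrict_iff_of_notMem
    (hL : ∀ e x y, ends e = s(x, y) → x ∈ L → y ∈ L ∨ y = r ∨ y = s) {x : V} (hx : x ∉ L) :
    x ∈ K2 ends r s ω ↔
      x ∈ K2 (fun e : {e // e ∉ within ends (L ∪ {r, s} : Set V)} => ends e.1) r s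
        (fun e => ω e.1) := by
  rw [mem_K2_iff, mem_K2_iff]
  constructor
  · intro h
    have h' : Conn ends ω x r ∨ Conn ends ω x s := h.imp conn_symm conn_symm
    rcases h' with h' | h' <;> rcases exit_of_conn hL hx h' with h'' | h'' | h''
    · exact Or.inl (conn_symm h'')
    · exact Or.inl (conn_symm h'')
    · exact Or.inr (conn_symm h'')
    · exact Or.inr (conn_symm h'')
    · exact Or.inl (conn_symm h'')
    · exact Or.inr (conn_symm h'')
  · rintro (h | h)
    · exact Or.inl (conn_of_conn_restrict h)
    · exact Or.inr (conn_of_conn_restrict h)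

/-- **Off `L`, the `W`-world of `{r, s}` is that of the restriction.** -/
lemma mem_M2_restrict_iff_of_notMem
    (hL : ∀ e x y, ends e = s(x, y) → x ∈ L → y ∈ L ∨ y = r ∨ y = s) {x : V} (hx : x ∉ L) :
    x ∈ M2 ends r s ω ↔
      x ∈ M2 (fun e : {e // e ∉ within ends (L ∪ {r, s} : Set V)} => ends e.1) r s
        (fun e => ω e.1) :=
  mem_K2_restrict_iff_of_notMem (ω := OneColourSwitch.compl ω) hL hx

/-- A vertex off `L` not joined to `r` or `s` in the restriction is not joined to `t ∈ {r, s}`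
in `G`. -/
lemma not_conn_mark_restrict_rootOnly
    (hL : ∀ e x y, ends e = s(x, y) → x ∈ L → y ∈ L ∨ y = r ∨ y = s) {u t : V} (hu : u ∉ L)
    (ht : t = r ∨ t = s)
    (h1 : ¬ Conn (fun e : {e // e ∉ within ends (L ∪ {r, s} : Set V)} => ends e.1)
      (fun e => ω e.1) u r)
    (h2 : ¬ Conn (fun e : {e // e ∉ within ends (L ∪ {r, s} : Set V)} => ends e.1)
      (fun e => ω e.1) u s) :
    ¬ Conn ends ω u t := by
  intro hc
  rcases exit_of_conn hL hu hc with h | h | h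
  · exact ht.elim (fun e => h1 (e ▸ h)) (fun e => h2 (e ▸ h))
  · exact h1 h
  · exact h2 h

/-- **`Sep` does not see a root-only cluster.** -/
lemma sep2_restrict_iff_rootOnly
    (hL : ∀ e x y, ends e = s(x, y) → x ∈ L → y ∈ L ∨ y = r ∨ y = s) (hp : p ∉ L) (hq : q ∉ L) :
    sep2 ends p q r s ω ↔
      sep2 (fun e : {e // e ∉ within ends (L ∪ {r, s} : Set V)} => ends e.1) p q r s
        (fun e => ω e.1) := by
  constructor
  · rintro ⟨⟨h1, h2, h3, h4⟩, ⟨h5, h6, h7, h8⟩⟩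
    exact ⟨⟨fun h => h1 (conn_of_conn_restrict h), fun h => h2 (conn_of_conn_restrict h),
      fun h => h3 (conn_of_conn_restrict h), fun h => h4 (conn_of_conn_restrict h)⟩,
      ⟨fun h => h5 (conn_of_conn_restrict (ω := OneColourSwitch.compl ω) h),
      fun h => h6 (conn_of_conn_restrict (ω := OneColourSwitch.compl ω) h),
      fun h => h7 (conn_of_conn_restrict (ω := OneColourSwitch.compl ω) h),
      fun h => h8 (conn_of_conn_restrict (ω := OneColourSwitch.compl ω) h)⟩⟩
  · rintro ⟨⟨h1, h2, h3, h4⟩, ⟨h5, h6, h7, h8⟩⟩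
    exact ⟨⟨not_conn_mark_restrict_rootOnly hL hp (Or.inl rfl) h1 h2,
      not_conn_mark_restrict_rootOnly hL hp (Or.inr rfl) h1 h2,
      not_conn_mark_restrict_rootOnly hL hq (Or.inl rfl) h3 h4,
      not_conn_mark_restrict_rootOnly hL hq (Or.inr rfl) h3 h4⟩,
      ⟨not_conn_mark_restrict_rootOnly (ω := OneColourSwitch.compl ω) hL hp (Or.inl rfl) h5 h6,
      not_conn_mark_restrict_rootOnly (ω := OneColourSwitch.compl ω) hL hp (Or.inr rfl) h5 h6,
      not_conn_mark_restrict_rootOnly (ω := OneColourSwitch.compl ω) hL hq (Or.inl rfl) h7 h8,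
      not_conn_mark_restrict_rootOnly (ω := OneColourSwitch.compl ω) hL hq (Or.inr rfl) h7 h8⟩⟩

/-- A `Y`-path from a vertex off `L` not `Y`-joined to `r` or `s` is a restricted `Y`-path. -/
lemma conn_restrict_of_conn_of_not_mark_rootOnly
    (hL : ∀ e x y, ends e = s(x, y) → x ∈ L → y ∈ L ∨ y = r ∨ y = s) {x y : V} (hx : x ∉ L)
    (hr : ¬ Conn ends ω x r) (hs : ¬ Conn ends ω x s) (h : Conn ends ω x y) :
    Conn (fun e : {e // e ∉ within ends (L ∪ {r, s} : Set V)} => ends e.1) (fun e => ω e.1) x y := by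
  rcases exit_of_conn hL hx h with h' | h' | h'
  · exact h'
  · exact (hr (conn_of_conn_restrict h')).elim
  · exact (hs (conn_of_conn_restrict h')).elim

/-- **`σ_pq` does not see a root-only cluster at a `Sep` point.** -/
lemma sigma_pq_restrict_eq_rootOnly
    (hL : ∀ e x y, ends e = s(x, y) → x ∈ L → y ∈ L ∨ y = r ∨ y = s) (hp : p ∉ L)
    (hsep : sep2 ends p q r s ω) :
    sigma ends ω p q =
      sigma (fun e : {e // e ∉ within ends (L ∪ {r, s} : Set V)} => ends e.1) (fun e => ω e.1)
        p q := by
  obtain ⟨⟨h1, h2, _, _⟩, ⟨h5, h6, _, _⟩⟩ := hsep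
  have hY : Conn ends ω p q ↔
      Conn (fun e : {e // e ∉ within ends (L ∪ {r, s} : Set V)} => ends e.1) (fun e => ω e.1)
        p q :=
    ⟨conn_restrict_of_conn_of_not_mark_rootOnly hL hp h1 h2, conn_of_conn_restrict⟩
  have hW : Conn ends (OneColourSwitch.compl ω) p q ↔
      Conn (fun e : {e // e ∉ within ends (L ∪ {r, s} : Set V)} => ends e.1)
        (fun e => OneColourSwitch.compl ω e.1) p q :=
    ⟨conn_restrict_of_conn_of_not_mark_rootOnly (ω := OneColourSwitch.compl ω) hL hp h5 h6,
      conn_of_conn_restrict⟩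
  unfold sigma
  rw [if_congr hY rfl rfl, if_congr hW rfl rfl]
  rfl

end Cluster

section FGraph

/-- A path of the `F`-graph (the edges inside `L ∪ {r, s}`) from a vertex of `L ∪ {r, s}`
stays in `L ∪ {r, s}`. -/
lemma mem_of_conn_F {x y : V} (hx : x ∈ (L ∪ {r, s} : Set V))
    (h : Conn (fun e : {e // ¬ (e ∉ within ends (L ∪ {r, s} : Set V))} => ends e.1)
      (fun e => ω e.1) x y) : y ∈ (L ∪ {r, s} : Set V) := by
  refine mem_of_conn_of_closed (S := (L ∪ {r, s} : Set V)) ?_ hx h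
  intro a _ b hab
  obtain ⟨_, e, _, hends⟩ := openGraph_adj.1 hab
  exact (mem_of_mem_within (not_not.1 e.2) hends).2

/-- **On `L`, the `Y`-world of `{r, s}` is that of the `F`-graph alone.** -/
lemma mem_K2_F_iff_of_mem (hL : ∀ e x y, ends e = s(x, y) → x ∈ L → y ∈ L ∨ y = r ∨ y = s)
    (hr : r ∉ L) (hs : s ∉ L) {x : V} (hx : x ∈ L) :
    x ∈ K2 ends r s ω ↔
      x ∈ K2 (fun e : {e // ¬ (e ∉ within ends (L ∪ {r, s} : Set V))} => ends e.1) r s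
        (fun e => ω e.1) := by
  rw [mem_K2_iff, mem_K2_iff]
  constructor
  · intro h
    have key : ∀ t, (t = r ∨ t = s) → Conn ends ω t x →
        Conn (fun e : {e // ¬ (e ∉ within ends (L ∪ {r, s} : Set V))} => ends e.1)
          (fun e => ω e.1) r x ∨
        Conn (fun e : {e // ¬ (e ∉ within ends (L ∪ {r, s} : Set V))} => ends e.1)
          (fun e => ω e.1) s x := by
      intro t ht hc
      have hmem : x ∈ {z | z ∈ L →
          Conn (fun e : {e // ¬ (e ∉ within ends (L ∪ {r, s} : Set V))} => ends e.1)
            (fun e => ω e.1) r z ∨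
          Conn (fun e : {e // ¬ (e ∉ within ends (L ∪ {r, s} : Set V))} => ends e.1)
            (fun e => ω e.1) s z} := by
        refine mem_of_conn_of_closed ?_ ?_ hc
        · intro a ha b hab
          simp only [Set.mem_setOf_eq] at ha ⊢
          intro hb
          obtain ⟨_, e, he, hends⟩ := openGraph_adj.1 hab
          have hF : e ∈ within ends (L ∪ {r, s} : Set V) :=
            mem_within_of_mem_L hL (by rw [hends, Sym2.eq_swap]) hb
          have hadj : Conn (fun e : {e // ¬ (e ∉ within ends (L ∪ {r, s} : Set V))} => ends e.1)
              (fun e => ω e.1) a b :=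
            conn_of_openAdj ⟨⟨e, not_not.2 hF⟩, he, hends⟩
          rcases hL e b a (by rw [hends, Sym2.eq_swap]) hb with haL | rfl | rfl
          · rcases ha haL with h' | h'
            · exact Or.inl (conn_trans h' hadj)
            · exact Or.inr (conn_trans h' hadj)
          · exact Or.inl hadj
          · exact Or.inr hadj
        · simp only [Set.mem_setOf_eq]
          intro htL
          rcases ht with rfl | rfl
          · exact (hr htL).elim
          · exact (hs htL).elim
      simp only [Set.mem_setOf_eq] at hmem
      exact hmem hx
    rcases h with h | h
    · exact key r (Or.inl rfl) h
    · exact key s (Or.inr rfl) h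
  · rintro (h | h)
    · exact Or.inl (conn_of_conn_restrict h)
    · exact Or.inr (conn_of_conn_restrict h)

/-- **On `L`, the `W`-world of `{r, s}` is that of the `F`-graph alone.** -/
lemma mem_M2_F_iff_of_mem (hL : ∀ e x y, ends e = s(x, y) → x ∈ L → y ∈ L ∨ y = r ∨ y = s)
    (hr : r ∉ L) (hs : s ∉ L) {x : V} (hx : x ∈ L) :
    x ∈ M2 ends r s ω ↔
      x ∈ M2 (fun e : {e // ¬ (e ∉ within ends (L ∪ {r, s} : Set V))} => ends e.1) r s
        (fun e => ω e.1) :=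
  mem_K2_F_iff_of_mem (ω := OneColourSwitch.compl ω) hL hr hs hx

/-- **`DOne` splits**: `DOne` in `G` is `DOne` of the restriction together with «no vertex of
`L` in both worlds of the `F`-graph». -/
lemma DOne_restrict_iff_rootOnly
    (hL : ∀ e x y, ends e = s(x, y) → x ∈ L → y ∈ L ∨ y = r ∨ y = s) (hr : r ∉ L) (hs : s ∉ L)
    (hd : d ∉ L) :
    DOne ends r s d ω ↔
      DOne (fun e : {e // e ∉ within ends (L ∪ {r, s} : Set V)} => ends e.1) r s d
        (fun e => ω e.1) ∧
      ∀ x ∈ L, x ∈ K2 (fun e : {e // ¬ (e ∉ within ends (L ∪ {r, s} : Set V))} => ends e.1) r s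
          (fun e => ω e.1) →
        x ∉ M2 (fun e : {e // ¬ (e ∉ within ends (L ∪ {r, s} : Set V))} => ends e.1) r s
          (fun e => ω e.1) := by
  constructor
  · intro h
    refine ⟨?_, ?_⟩
    · intro x hxr hxs hxd hK hM
      by_cases hxL : x ∈ L
      · rcases mem_K2_iff.1 hK with h' | h'
        · exact notMem_L_of_conn_restrict hL hr h' hxL
        · exact notMem_L_of_conn_restrict hL hs h' hxL
      · exact h x hxr hxs hxd ((mem_K2_restrict_iff_of_notMem hL hxL).2 hK)
          ((mem_M2_restrict_iff_of_notMem hL hxL).2 hM)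
    · intro x hxL hK hM
      have hxr : x ≠ r := fun h' => hr (h' ▸ hxL)
      have hxs : x ≠ s := fun h' => hs (h' ▸ hxL)
      have hxd : x ≠ d := fun h' => hd (h' ▸ hxL)
      exact h x hxr hxs hxd ((mem_K2_F_iff_of_mem hL hr hs hxL).2 hK)
        ((mem_M2_F_iff_of_mem hL hr hs hxL).2 hM)
  · rintro ⟨h1, h2⟩ x hxr hxs hxd hK hM
    by_cases hxL : x ∈ L
    · exact h2 x hxL ((mem_K2_F_iff_of_mem hL hr hs hxL).1 hK)
        ((mem_M2_F_iff_of_mem hL hr hs hxL).1 hM)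
    · exact h1 x hxr hxs hxd ((mem_K2_restrict_iff_of_notMem hL hxL).1 hK)
        ((mem_M2_restrict_iff_of_notMem hL hxL).1 hM)

/-- **`r ~_Y s` holds iff it holds in the restriction or in the `F`-graph.** -/
lemma conn_rs_restrict_iff_rootOnly
    (hL : ∀ e x y, ends e = s(x, y) → x ∈ L → y ∈ L ∨ y = r ∨ y = s) (hr : r ∉ L) (hs : s ∉ L) :
    Conn ends ω r s ↔
      Conn (fun e : {e // e ∉ within ends (L ∪ {r, s} : Set V)} => ends e.1) (fun e => ω e.1)
        r s ∨
      Conn (fun e : {e // ¬ (e ∉ within ends (L ∪ {r, s} : Set V))} => ends e.1)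
        (fun e => ω e.1) r s := by
  constructor
  · intro h
    have key : s ∈ {z |
        Conn (fun e : {e // e ∉ within ends (L ∪ {r, s} : Set V)} => ends e.1) (fun e => ω e.1)
          r z ∨
        Conn (fun e : {e // ¬ (e ∉ within ends (L ∪ {r, s} : Set V))} => ends e.1)
          (fun e => ω e.1) r z ∨
        (Conn (fun e : {e // ¬ (e ∉ within ends (L ∪ {r, s} : Set V))} => ends e.1)
          (fun e => ω e.1) r s ∧
          Conn (fun e : {e // e ∉ within ends (L ∪ {r, s} : Set V)} => ends e.1)
            (fun e => ω e.1) s z) ∨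
        (Conn (fun e : {e // e ∉ within ends (L ∪ {r, s} : Set V)} => ends e.1) (fun e => ω e.1)
          r s ∧
          Conn (fun e : {e // ¬ (e ∉ within ends (L ∪ {r, s} : Set V))} => ends e.1)
            (fun e => ω e.1) s z)} := by
      refine mem_of_conn_of_closed ?_ (Or.inl (conn_refl _ _ _)) h
      intro a ha b hab
      simp only [Set.mem_setOf_eq] at ha ⊢
      obtain ⟨_, e, he, hends⟩ := openGraph_adj.1 hab
      by_cases hP : e ∈ within ends (L ∪ {r, s} : Set V)
      · -- an edge of the `F`-graph
        have hadj : Conn (fun e : {e // ¬ (e ∉ within ends (L ∪ {r, s} : Set V))} => ends e.1)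
            (fun e => ω e.1) a b :=
          conn_of_openAdj ⟨⟨e, not_not.2 hP⟩, he, hends⟩
        rcases ha with ha | ha | ⟨hrs, ha⟩ | ⟨hrs, ha⟩
        · -- `a` is on a restricted path from `r`: `a = r` or `a = s`
          have haL : a ∉ L := notMem_L_of_conn_restrict hL hr ha
          obtain ⟨ha', _⟩ := mem_of_mem_within hP hends
          simp only [Set.mem_union, Set.mem_insert_iff, Set.mem_singleton_iff] at ha'
          rcases ha' with ha' | rfl | rfl
          · exact (haL ha').elim
          · exact Or.inr (Or.inl hadj)
          · exact Or.inr (Or.inr (Or.inr ⟨ha, hadj⟩))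
        · exact Or.inr (Or.inl (conn_trans ha hadj))
        · have haL : a ∉ L := notMem_L_of_conn_restrict hL hs ha
          obtain ⟨ha', _⟩ := mem_of_mem_within hP hends
          simp only [Set.mem_union, Set.mem_insert_iff, Set.mem_singleton_iff] at ha'
          rcases ha' with ha' | rfl | rfl
          · exact (haL ha').elim
          · exact Or.inr (Or.inl hadj)
          · exact Or.inr (Or.inl (conn_trans hrs hadj))
        · exact Or.inr (Or.inr (Or.inr ⟨hrs, conn_trans ha hadj⟩))
      · -- an edge off `F`
        have hadj : Conn (fun e : {e // e ∉ within ends (L ∪ {r, s} : Set V)} => ends e.1)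
            (fun e => ω e.1) a b :=
          conn_of_openAdj ⟨⟨e, hP⟩, he, hends⟩
        have haL : a ∉ L := (notMem_L_of_notMem_within hL hP hends).1
        rcases ha with ha | ha | ⟨hrs, ha⟩ | ⟨hrs, ha⟩
        · exact Or.inl (conn_trans ha hadj)
        · -- `a` is on an `F`-path from `r`: `a ∈ L ∪ {r, s}`, not in `L`
          have ha' := mem_of_conn_F (by simp) ha
          simp only [Set.mem_union, Set.mem_insert_iff, Set.mem_singleton_iff] at ha'
          rcases ha' with ha' | rfl | rfl
          · exact (haL ha').elim
          · exact Or.inl hadj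
          · exact Or.inr (Or.inr (Or.inl ⟨ha, hadj⟩))
        · exact Or.inr (Or.inr (Or.inl ⟨hrs, conn_trans ha hadj⟩))
        · have ha' := mem_of_conn_F (by simp) ha
          simp only [Set.mem_union, Set.mem_insert_iff, Set.mem_singleton_iff] at ha'
          rcases ha' with ha' | rfl | rfl
          · exact (haL ha').elim
          · exact Or.inl hadj
          · exact Or.inl (conn_trans hrs hadj)
    simp only [Set.mem_setOf_eq] at key
    rcases key with h' | h' | ⟨h', _⟩ | ⟨h', _⟩
    · exact Or.inl h'
    · exact Or.inr h'
    · exact Or.inr h'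
    · exact Or.inl h'
  · rintro (h | h)
    · exact conn_of_conn_restrict h
    · exact conn_of_conn_restrict h

end FGraph

end NoPocket

end Summit.Ventures.PercRepro2
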